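import Summits.Ventures.HSemireg.Mod4TwoSlopeSpectrumGeneral
import Summits.Ventures.HSemireg.Mod4CarrierMiddleMatrix

/-!
# Venture HSemireg — MOD-4 line: the PURE MIDDLE h-part `f = q_n hⁿ/n!` (`q_m = 0` for `m ≠ n`, `q_n ≠ 0`) AT ITS PINS, every `n`:
# the drop `#{b ≤ n : C(n,b) = C(n,a)}` at the pin `t = (−1)ⁿ C(n,a)² q_n²` IS `2` for `2a ≠ n` and `1` for `2a = n`

HONEST FRAMING. Part of the Lean index of the computation cell `pub-hsemireg` (seat w3-mod4-1 gen 14, W3 SPECIAL FIBRES; file of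
record `HOME/widen/W3/MOD4-OFFSPLIT-w3mod4.md` §12.6 (seat g5/g6: `Mod4Site.finrank_ker_middleM_carrier` — `dim ker(M_f − λ) =
#{a ≤ n : (−1)ⁿ c² C(n,a)² = λ}` for the carrier `q = c·δ_n`, with the counts `2 ∕ 1` decided by `decide` at `n = 2, 3, 4` in
`Mod4CarrierRZ` ∕ `Mod4CarrierRZMore`) and §13.23–13.25). THIS FILE ADDS ONLY the count for EVERY `n` (binomial injectivity on
`[0, n/2]`) and repackages it in the hypothesis form used by the real-carrier files of §13 (`q_m = 0` for `m ≠ n`; kernel of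
`toLin' M_f − t • id`). ELEMENTARY ARITHMETIC ∕ LINEAR ALGEBRA over a field ONLY: no abelian variety, no sheaf, no Ext group, no
semiregularity map; nothing here says that HC / HC_CM / HC_AV holds; no Literature fact is declared; NO definition is introduced.

WHAT IS PROVED (`K` a field; `CharZero K` where binomial coefficients are compared):
* **`choose_lt_choose_succ_of_lt_half`** — `C(n,m) < C(n,m+1)` for `m < n/2` (from Mathlib's `Nat.choose_succ_right_eq`);
* **`choose_injOn_half`**, **`choose_eq_choose_iff`** — for `a, b ≤ n`: `C(n,b) = C(n,a) ↔ b = a ∨ b + a = n`;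
* **`card_filter_choose_eq`** — `#{b ≤ n : C(n,b) = C(n,a)} = 1` if `2a = n`, else `2`;
* **`card_filter_carrier_pin`** — `#{b ≤ n : (−1)ⁿ q_n² C(n,b)² = (−1)ⁿ C(n,a)² q_n²} = (1 | 2)` (`q_n ≠ 0`);
* **`finrank_ker_middleM_pure`** — `q_m = 0` (`m ≠ n`), `q_n ≠ 0`, `a ≤ n`, `t = (−1)ⁿ C(n,a)² q_n²`:
  `dim ker(M_f(q) − t) = if 2a = n then 1 else 2` — the tree's `Mod4Site.middleM_carrier` ∕ `finrank_ker_middleM_carrier` (seat g5)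
  composed with `card_filter_choose_eq`.
With FILE 13's `finrank_S_weilType_middle` this is the pure row's middle entry AT EVERY PIN on the REAL carrier for every `n`
(`WeilFramePureMiddle`): `22, 23` (`n = 2`), `110, 110` (`n = 3`), `478, 478, 479` (`n = 4`) — the values the MODEL-carrier files
`Mod4CarrierRZ` ∕ `Mod4CarrierRZMore` (seat g6) already carry case by case. Everything PROVED, 0 sorry. Namespace `Summit.Ventures.HSemireg.Mod4`.
References: [BourbakiAlgebre1a3] Ch. III §8 (rank, diagonal matrices); [BuchweitzFlenner2008HH] Prop. 6.4.4 (why this matrix).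
-/

/-- **strict unimodality of the binomial coefficients, left half:** `C(n,m) < C(n,m+1)` for `m < n/2`
(`C(n,m+1)(m+1) = C(n,m)(n−m)` and `n − m ≥ m + 2`). [cite: BourbakiAlgebre1a3, Ch. III §8] -/
theorem Summit.Ventures.HSemireg.Mod4.choose_lt_choose_succ_of_lt_half {n m : ℕ} (h : m < n / 2) :
    n.choose m < n.choose (m + 1) := by
  have hpos : 0 < n.choose m := Nat.choose_pos (by omega)
  have key := Nat.choose_succ_right_eq n m
  -- `choose n (m+1) * (m+1) = choose n m * (n - m)` with `n - m ≥ m + 2`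
  by_contra hle
  rw [not_lt] at hle
  have h1 : n.choose (m + 1) * (m + 1) ≤ n.choose m * (m + 1) := Nat.mul_le_mul_right _ hle
  have h2 : n.choose m * (m + 2) ≤ n.choose m * (n - m) := Nat.mul_le_mul_left _ (by omega)
  have h3 : n.choose m * (m + 1) < n.choose m * (m + 2) := Nat.mul_lt_mul_of_pos_left (by omega) hpos
  omega

namespace Summit.Ventures.HSemireg.Mod4

open Finset Matrix

/-- **`C(n,·)` is injective on `[0, n/2]`.** [cite: BourbakiAlgebre1a3, Ch. III §8] -/
theorem choose_injOn_half (n : ℕ) : Set.InjOn n.choose (Set.Iic (n / 2)) := by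
  have h : StrictMonoOn n.choose (Set.Iic (n / 2)) :=
    strictMonoOn_Iic_of_lt_succ (ψ := n.choose) (n := n / 2) fun m hm => choose_lt_choose_succ_of_lt_half hm
  exact h.injOn

/-- **`C(n,b) = C(n,a) ↔ b = a ∨ b + a = n`** for `a, b ≤ n` (fold both indices into `[0, n/2]` by `C(n,k) = C(n,n−k)`).
[cite: BourbakiAlgebre1a3, Ch. III §8] -/
theorem choose_eq_choose_iff {n a b : ℕ} (ha : a ≤ n) (hb : b ≤ n) :
    n.choose b = n.choose a ↔ b = a ∨ b + a = n := by
  constructor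
  · intro h
    -- fold into the left half
    set a' := if a ≤ n / 2 then a else n - a with ha'
    set b' := if b ≤ n / 2 then b else n - b with hb'
    have ha'le : a' ≤ n / 2 := by rw [ha']; split_ifs <;> omega
    have hb'le : b' ≤ n / 2 := by rw [hb']; split_ifs <;> omega
    have hca : n.choose a' = n.choose a := by
      rw [ha']; split_ifs with h1
      · rfl
      · exact Nat.choose_symm ha
    have hcb : n.choose b' = n.choose b := by
      rw [hb']; split_ifs with h1
      · rfl
      · exact Nat.choose_symm hb
    have heq : b' = a' := choose_injOn_half n (Set.mem_Iic.mpr hb'le) (Set.mem_Iic.mpr ha'le) (by rw [hcb, hca, h])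
    rw [ha', hb'] at heq
    split_ifs at heq <;> omega
  · rintro (rfl | h)
    · rfl
    · rw [show b = n - a by omega, Nat.choose_symm ha]

/-- **the pin multiplicity:** `#{b ≤ n : C(n,b) = C(n,a)} = 1` if `2a = n` (then `b = a = n − a`), else `2` (`b ∈ {a, n − a}`).
[cite: BourbakiAlgebre1a3, Ch. III §8] -/
theorem card_filter_choose_eq {n a : ℕ} (ha : a ≤ n) :
    (Finset.univ.filter fun b : Fin (n + 1) => n.choose (b : ℕ) = n.choose a).card = if 2 * a = n then 1 else 2 := by
  have hset : (Finset.univ.filter fun b : Fin (n + 1) => n.choose (b : ℕ) = n.choose a) =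
      {(⟨a, by omega⟩ : Fin (n + 1)), ⟨n - a, by omega⟩} := by
    ext b
    simp only [Finset.mem_filter, Finset.mem_univ, true_and, Finset.mem_insert, Finset.mem_singleton, Fin.ext_iff]
    rw [choose_eq_choose_iff ha (by omega)]
    omega
  rw [hset]
  split_ifs with h2
  · have : (⟨a, by omega⟩ : Fin (n + 1)) = ⟨n - a, by omega⟩ := Fin.ext (by simp only; omega)
    rw [this, Finset.pair_eq_singleton, Finset.card_singleton]
  · rw [Finset.card_pair]
    intro h
    simp only [Fin.ext_iff] at h
    omega

variable {K : Type*} [Field K]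

/-- **the carrier pin set counted:** for `q_n ≠ 0`, `a ≤ n` (`CharZero K`):
`#{b ≤ n : (−1)ⁿ q_n² C(n,b)² = (−1)ⁿ C(n,a)² q_n²} = 1` if `2a = n`, else `2` (`C(n,b)² = C(n,a)²` in `K` iff `C(n,b) = C(n,a)` in `ℕ`).
[cite: BourbakiAlgebre1a3, Ch. III §8] -/
theorem card_filter_carrier_pin [CharZero K] [DecidableEq K] {n : ℕ} {c : K} (hc : c ≠ 0) {a : ℕ} (ha : a ≤ n) :
    (Finset.univ.filter fun b : Fin (n + 1) =>
        (-1 : K) ^ n * c ^ 2 * (n.choose (b : ℕ) : K) ^ 2 = (-1 : K) ^ n * ((n.choose a : K) * (n.choose a : K)) * (c * c)).card =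
      if 2 * a = n then 1 else 2 := by
  rw [← card_filter_choose_eq ha]
  congr 1
  refine Finset.filter_congr fun b _ => ?_
  have hu : ((-1 : K) ^ n * (c * c)) ≠ 0 := mul_ne_zero (pow_ne_zero _ (neg_ne_zero.mpr one_ne_zero)) (mul_ne_zero hc hc)
  constructor
  · intro h
    have h1 : ((-1 : K) ^ n * (c * c)) * (((n.choose (b : ℕ) : K)) ^ 2 - ((n.choose a : K)) ^ 2) = 0 := by
      linear_combination h
    have h2 : ((n.choose (b : ℕ) : K)) ^ 2 = ((n.choose a : K)) ^ 2 := sub_eq_zero.mp ((mul_eq_zero.mp h1).resolve_left hu)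
    have h3 : ((n.choose (b : ℕ) ^ 2 : ℕ) : K) = ((n.choose a ^ 2 : ℕ) : K) := by push_cast; exact h2
    exact Nat.pow_left_injective two_ne_zero (Nat.cast_injective h3)
  · intro h
    rw [h]
    ring

/-- **TABLE R's pure middle row AT A PIN, every `n`:** for `q_m = 0` (`m ≠ n`), `q_n ≠ 0`, `a ≤ n` and
`t = (−1)ⁿ C(n,a)² q_n²`: `dim ker(M_f(q) − t) = 1` if `2a = n`, else `2` — the tree's `Mod4Site.middleM_carrier` ∕
`Mod4Site.finrank_ker_middleM_carrier` (`M_f(q)` is the diagonal matrix `(−1)ⁿ q_n² C(n,b)²`) with the count `card_filter_carrier_pin`.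
[cite: BourbakiAlgebre1a3, Ch. III §8] [cite: BuchweitzFlenner2008HH, Prop. 6.4.4] -/
theorem finrank_ker_middleM_pure [CharZero K] {n : ℕ} {q : ℕ → K} (hq : ∀ m, m ≠ n → q m = 0) (hqn : q n ≠ 0)
    {a : ℕ} (ha : a ≤ n) {t : K} (ht : t = (-1 : K) ^ n * ((n.choose a : K) * (n.choose a : K)) * (q n * q n)) :
    Module.finrank K ↥(LinearMap.ker (Matrix.toLin' (middleM n q) - t • LinearMap.id)) = if 2 * a = n then 1 else 2 := by
  classical
  -- `q` IS the carrier sequence `c·δ_n` with `c = q n`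
  have hq' : q = fun i => if i = n then q n else 0 := by
    funext i
    by_cases hi : i = n
    · rw [hi, if_pos rfl]
    · rw [if_neg hi, hq i hi]
  have hlin : Matrix.toLin' (middleM n q) - t • LinearMap.id =
      (middleM n (fun i => if i = n then q n else 0) - t • (1 : Matrix (Fin (n + 1)) (Fin (n + 1)) K)).mulVecLin := by
    rw [← Matrix.toLin'_apply', map_sub, map_smul, Matrix.toLin'_one, ← hq']
  rw [hlin, Mod4Site.finrank_ker_middleM_carrier, ← card_filter_carrier_pin hqn ha, ht]

end Summit.Ventures.HSemireg.Mod4
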